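import Summits.QuantumFields.YangMills.Theorems.UnitScaleTiltProp7CovLinAvgStructureStep
import Literature.MathematicalPhysics.QuantumFieldTheory.Balaban1983to89.T4Covariance
import HarnessLib

/-!
# Route `UnitScaleTilt`, crux K1 «MinimiserStabilityRegPr» (stmt-QuantumFields-19200), route-R [RP] at a curved background ∕ (α) (AVG-SYM) operator junction —
# THE CURVED N6, SECOND BRICK: PURE GAUGES — the covariant signed sum of a linearised gauge mode TELESCOPES EXACTLY at any background,
# `Y_{U₀}(Γ)(ξ) = ξ(start) − U₀(Γ)·ξ(end)·U₀(Γ)*` for `Y_b = ξ(b₋) − U₀,b ξ(b₊) U₀,b*`; hence the main-term linearisation `Q₁(U₀)` of (124) maps it to the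
# TRANSPORTED COARSE DIFFERENCE `ξ(emb y) − Ū₀(c) ξ(emb y′) Ū₀(c)*` PLUS the commutators `|I|⁻¹Σ_i (ξ(emb y) − W⁰_i ξ(emb y) W⁰_i*)` with the background loop variables

Cell `ym3-torus`, width seat `ym-ust-20520-w2` (g2); sequel of ⧗ p602235 `…Prop7CovLinAvgStructureStep` and of the LOCATED notes `S2-CURVED-LOCATED-w2g2.md`
(§2 row «(1.20) ∕ N6 gauge part», there claimed EXACT for the TRUE derivative — this file shows what the tree's MAIN-TERM linearisation `covLinAvg` gives: exact up to the
loop-variable commutators, which the true derivative `Prop7AvgTrueLinearisation` re-absorbs) and `CURVED-N6-LOCATED-w2g2.md` (row (R-A): the curved twin of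
`Prop7IterLinStructureRec.iterLambda_grad`'s one step).  THEOREMS ONLY (0 `def`, 0 `sorry`); `--supports stmt-QuantumFields-19200`, count-neutral.  YM₃ on T³ is a
ladder rung (R3), not the Clay problem; nothing here claims the curved N6, S2, P, the crux or the gap.

WHAT IS PROVED (ns `…Theorems.Prop7CovLinAvgPureGauge`; `U₀` an `SU(N)` configuration on `T^{(j)}`, `ξ : Site → M_N(ℂ)` any site function; the linearised LEFT gauge
mode is written as the explicit bond field `fun b => ξ b.src − U₀,b·ξ b.tgt·U₀,b*`, the derivative at `t = 0` of `(e^{tξ}·U₀)U₀⁻¹`, [Balaban1985Variational] (15)).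
* §1 ★ `covWalkSum_pureGauge_walk` — **COVARIANT TELESCOPING**: for every base site `x` and word `w`,
  `Y_{U₀}(walk x w) = ξ(x) − U₀(walk x w)·ξ(walkEnd x w)·U₀(walk x w)*` (induction on the word; forward and backward steps alike).
* §2 `covWalkSum_pureGauge_loop` (closed loop words: `= ξ(emb c₋) − W⁰_i ξ(emb c₋) W⁰_i*`), `covWalkSum_pureGauge_segment` (`= ξ(emb c₋) − Ū₀(c) ξ(emb c₊) Ū₀(c)*`),
  ★★ `covLinAvg_pureGauge` — `(Q₁(U₀)Y_ξ)(c) = (ξ(emb c₋) − Ū₀(c)·ξ(emb c₊)·Ū₀(c)*) + |I|⁻¹Σ_i (ξ(emb c₋) − W⁰_i·ξ(emb c₋)·W⁰_i*)` (exact), and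
  ★ `norm_covLinAvg_pureGauge_sub_le` — the commutator mean is `≤ 2α·‖ξ(emb c₋)‖` when `dist1(W⁰_i) ≤ α`.
HONEST SCOPE.  Exact lattice algebra + one triangle inequality.  The statement for the TRUE derivative (no commutator term, by the exact covariance (0.6) `M(uW_iu⁻¹) = uM(W)u⁻¹`)
is left to the `Prop7AvgTrueLinearisation` letters.

References: T. Bałaban, CMP 98 (1985) 17–51 [Balaban1985Averaging] ((8) p.18, (58) p.27, (62)–(63) p.28, (124) p.36); CMP 95 (1984) 17–40 [Balaban1984PropagatorsI] ((1.20) p.20);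
CMP 102 (1985) 277–309 [Balaban1985Variational] ((15) p.280).
-/

noncomputable section

open scoped BigOperators Matrix.Norms.L2Operator

namespace Summit.QuantumFields.YangMills.Theorems.Prop7CovLinAvgPureGauge

open Literature.MathematicalPhysics.QuantumFieldTheory.Balaban1983to89
open Finset T4Continuum BlockAveraging AveragingRT ExpMeanLog BlockAveragingEMLLinearised BlockAveragingEMLLinearisedBackground BlockAveragingEMLProp2
open Summit.QuantumFields.YangMills.Theorems.Prop7HolRatioPerStep (norm_coe_eq_one norm_star_coe_eq_one coe_star_mul_self coe_mul_star_self)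
open Summit.QuantumFields.YangMills.Theorems.Prop7CovLinAvgStructureStep (norm_conj_mul_sub_conj_le)

variable {P : Params} {n : Type*} [Fintype n] [DecidableEq n] [Nonempty n] {j : ℕ}

/-! ## §1 ★ Covariant telescoping of a linearised gauge mode -/

/-- The forward-step algebra of the telescoping (free ring identity). [folklore] -/
theorem telescope_fwd {R : Type*} [Ring R] (ξx ξy ξe U Us H Hs : R) :
    (ξx - U * ξy * Us) + U * (ξy - H * ξe * Hs) * Us = ξx - U * H * ξe * (Hs * Us) := by
  noncomm_ring

/-- The backward-step algebra of the telescoping (`Us·U = 1`). [folklore] -/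
theorem telescope_bwd {R : Type*} [Ring R] (ξx' ξx ξe U Us H Hs : R) (h : Us * U = 1) :
    -(Us * (ξx' - U * ξx * Us) * U) + Us * (ξx' - H * ξe * Hs) * U = ξx - Us * H * ξe * (Hs * U) := by
  have e : Us * (ξx' - U * ξx * Us) * U = Us * ξx' * U - (Us * U) * ξx * (Us * U) := by noncomm_ring
  rw [e, h, one_mul, mul_one]
  noncomm_ring

/-- ★ **COVARIANT TELESCOPING**: for the linearised left gauge mode `Y_b = ξ(b₋) − U₀,b ξ(b₊) U₀,b*`, the covariant signed sum along any lattice walk is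
`ξ(start) − U₀(walk)·ξ(end)·U₀(walk)*`. [cite: Balaban1985Averaging, (8) p.18, (58) p.27] -/
theorem covWalkSum_pureGauge_walk (U₀ : GaugeField P j (Matrix.specialUnitaryGroup n ℂ)) (ξ : Site P j → Matrix n n ℂ) :
    ∀ (x : Site P j) (w : List (Letter P.d)),
      covWalkSum U₀ (fun b : PBond P j => ξ b.src - ((U₀ b : Matrix.specialUnitaryGroup n ℂ) : Matrix n n ℂ) * ξ b.tgt *
          star ((U₀ b : Matrix.specialUnitaryGroup n ℂ) : Matrix n n ℂ)) (walk x w)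
        = ξ x - ((holAt U₀ (walk x w) : Matrix.specialUnitaryGroup n ℂ) : Matrix n n ℂ) * ξ (walkEnd x w) *
            star ((holAt U₀ (walk x w) : Matrix.specialUnitaryGroup n ℂ) : Matrix n n ℂ)
  | x, [] => by simp [walk, walkEnd, holAt_nil]
  | x, (μ, true) :: w => by
    have ih := covWalkSum_pureGauge_walk U₀ ξ (x.shift μ) w
    rw [show walk x ((μ, true) :: w) = ⟨⟨x, μ⟩, true⟩ :: walk (x.shift μ) w from rfl,
      show walkEnd x ((μ, true) :: w) = walkEnd (x.shift μ) w from rfl,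
      covWalkSum_cons, holAt_cons, ih]
    simp only [covStep, stepFactor, if_true, Submonoid.coe_mul, star_mul]
    exact telescope_fwd _ _ _ _ _ _ _
  | x, (μ, false) :: w => by
    have ih := covWalkSum_pureGauge_walk U₀ ξ (x.unshift μ) w
    have htgt : (⟨x.unshift μ, μ⟩ : PBond P j).tgt = x := Site.shift_unshift x μ
    have hUU := coe_star_mul_self (U₀ ⟨x.unshift μ, μ⟩)
    have hinv : (((U₀ ⟨x.unshift μ, μ⟩)⁻¹ : Matrix.specialUnitaryGroup n ℂ) : Matrix n n ℂ)
        = star ((U₀ ⟨x.unshift μ, μ⟩ : Matrix.specialUnitaryGroup n ℂ) : Matrix n n ℂ) := rfl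
    rw [show walk x ((μ, false) :: w) = ⟨⟨x.unshift μ, μ⟩, false⟩ :: walk (x.unshift μ) w from rfl,
      show walkEnd x ((μ, false) :: w) = walkEnd (x.unshift μ) w from rfl,
      covWalkSum_cons, holAt_cons, ih]
    simp only [covStep, stepFactor, Bool.false_eq_true, if_false, Submonoid.coe_mul, hinv, star_mul, star_star, htgt]
    exact telescope_bwd _ _ _ _ _ _ _ hUU

/-! ## §2 The main-term linearisation of (124) on a pure gauge -/

/-- On the closed loop words of (0.4) the telescoped sum is the commutator with the loop variable: `Y_{U₀}(loop_i) = ξ(emb c₋) − W⁰_i·ξ(emb c₋)·W⁰_i*`.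
[cite: Balaban1985Averaging, (58) p.27; Balaban1987RG1, (0.4) p.253] -/
theorem covWalkSum_pureGauge_loop (U₀ : GaugeField P j (Matrix.specialUnitaryGroup n ℂ)) (ξ : Site P j → Matrix n n ℂ) (c : PBond P (j + 1)) (i : Idx P) :
    covWalkSum U₀ (fun b : PBond P j => ξ b.src - ((U₀ b : Matrix.specialUnitaryGroup n ℂ) : Matrix n n ℂ) * ξ b.tgt *
        star ((U₀ b : Matrix.specialUnitaryGroup n ℂ) : Matrix n n ℂ)) (walk (emb c.src) (loopWord P.L c.dir (off i.1) i.2.1 i.2.2))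
      = ξ (emb c.src) - ((loopHol U₀ c i : Matrix.specialUnitaryGroup n ℂ) : Matrix n n ℂ) * ξ (emb c.src) *
          star ((loopHol U₀ c i : Matrix.specialUnitaryGroup n ℂ) : Matrix n n ℂ) := by
  rw [covWalkSum_pureGauge_walk, walkEnd_eq_self_of_netDisp (fun ν => by rw [netDisp_loopWord, Int.cast_zero])]
  rfl

/-- On the straight segment `[emb c₋, emb c₊]`: `Y_{U₀}([y,y′]) = ξ(emb c₋) − Ū₀(c)·ξ(emb c₊)·Ū₀(c)*` (`Ū₀(c) = axialAvg U₀ c`). [cite: Balaban1984PropagatorsI, (1.20) p.20] -/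
theorem covWalkSum_pureGauge_segment (U₀ : GaugeField P j (Matrix.specialUnitaryGroup n ℂ)) (ξ : Site P j → Matrix n n ℂ) (c : PBond P (j + 1)) :
    covWalkSum U₀ (fun b : PBond P j => ξ b.src - ((U₀ b : Matrix.specialUnitaryGroup n ℂ) : Matrix n n ℂ) * ξ b.tgt *
        star ((U₀ b : Matrix.specialUnitaryGroup n ℂ) : Matrix n n ℂ)) (walk (emb c.src) (List.replicate P.L (c.dir, true)))
      = ξ (emb c.src) - ((axialAvg U₀ c : Matrix.specialUnitaryGroup n ℂ) : Matrix n n ℂ) * ξ (emb c.tgt) *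
          star ((axialAvg U₀ c : Matrix.specialUnitaryGroup n ℂ) : Matrix n n ℂ) := by
  rw [covWalkSum_pureGauge_walk, walkEnd_replicate_L, axialAvg_eq_holAt_walk]
  rfl

/-- ★★ **THE MAIN-TERM LINEARISATION OF (124) ON A PURE GAUGE**: `(Q₁(U₀)Y_ξ)(c) = (ξ(emb c₋) − Ū₀(c)·ξ(emb c₊)·Ū₀(c)*) + |I|⁻¹Σ_i (ξ(emb c₋) − W⁰_i·ξ(emb c₋)·W⁰_i*)`
— the transported coarse difference (the curved (1.20)) plus the mean of the commutators with the background's loop variables (zero at a flat background).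
[cite: Balaban1985Averaging, (124) p.36; Balaban1984PropagatorsI, (1.20) p.20] -/
theorem covLinAvg_pureGauge (U₀ : GaugeField P j (Matrix.specialUnitaryGroup n ℂ)) (ξ : Site P j → Matrix n n ℂ) (c : PBond P (j + 1)) :
    covLinAvg U₀ (fun b : PBond P j => ξ b.src - ((U₀ b : Matrix.specialUnitaryGroup n ℂ) : Matrix n n ℂ) * ξ b.tgt *
        star ((U₀ b : Matrix.specialUnitaryGroup n ℂ) : Matrix n n ℂ)) c
      = (ξ (emb c.src) - ((axialAvg U₀ c : Matrix.specialUnitaryGroup n ℂ) : Matrix n n ℂ) * ξ (emb c.tgt) *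
            star ((axialAvg U₀ c : Matrix.specialUnitaryGroup n ℂ) : Matrix n n ℂ))
        + ((Fintype.card (Idx P) : ℂ))⁻¹ • ∑ i : Idx P,
            (ξ (emb c.src) - ((loopHol U₀ c i : Matrix.specialUnitaryGroup n ℂ) : Matrix n n ℂ) * ξ (emb c.src) *
              star ((loopHol U₀ c i : Matrix.specialUnitaryGroup n ℂ) : Matrix n n ℂ)) := by
  rw [covLinAvg_def, covWalkSum_pureGauge_segment]
  simp only [covWalkSum_pureGauge_loop]
  abel

/-- ★ **… AND ITS DEFECT IS `O(α)`**: if `dist1(W⁰_i) ≤ α` for every loop variable at `c`, the commutator mean is at most `2α‖ξ(emb c₋)‖`, so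
`‖(Q₁(U₀)Y_ξ)(c) − (ξ(emb c₋) − Ū₀(c)ξ(emb c₊)Ū₀(c)*)‖ ≤ 2α·‖ξ(emb c₋)‖`. [cite: Balaban1985Averaging, (124) p.36] -/
theorem norm_covLinAvg_pureGauge_sub_le (U₀ : GaugeField P j (Matrix.specialUnitaryGroup n ℂ)) (ξ : Site P j → Matrix n n ℂ) (c : PBond P (j + 1))
    {α : ℝ} (hα : ∀ i : Idx P, dist1 (loopHol U₀ c i) ≤ α) :
    ‖covLinAvg U₀ (fun b : PBond P j => ξ b.src - ((U₀ b : Matrix.specialUnitaryGroup n ℂ) : Matrix n n ℂ) * ξ b.tgt *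
          star ((U₀ b : Matrix.specialUnitaryGroup n ℂ) : Matrix n n ℂ)) c
        - (ξ (emb c.src) - ((axialAvg U₀ c : Matrix.specialUnitaryGroup n ℂ) : Matrix n n ℂ) * ξ (emb c.tgt) *
            star ((axialAvg U₀ c : Matrix.specialUnitaryGroup n ℂ) : Matrix n n ℂ))‖
      ≤ 2 * α * ‖ξ (emb c.src)‖ := by
  classical
  have hI : (0 : ℝ) < (Fintype.card (Idx P) : ℝ) := by exact_mod_cast Fintype.card_pos
  rw [covLinAvg_pureGauge, add_sub_cancel_left, norm_smul, norm_inv, Complex.norm_natCast]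
  have hpt : ∀ i : Idx P, ‖ξ (emb c.src) - ((loopHol U₀ c i : Matrix.specialUnitaryGroup n ℂ) : Matrix n n ℂ) * ξ (emb c.src) *
      star ((loopHol U₀ c i : Matrix.specialUnitaryGroup n ℂ) : Matrix n n ℂ)‖ ≤ 2 * α * ‖ξ (emb c.src)‖ := by
    intro i
    have h1 := norm_conj_mul_sub_conj_le (loopHol U₀ c i) 1 (ξ (emb c.src))
    simp only [mul_one, OneMemClass.coe_one, one_mul, star_one] at h1
    have hW1 : ‖((loopHol U₀ c i : Matrix.specialUnitaryGroup n ℂ) : Matrix n n ℂ) - 1‖ ≤ α := by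
      rw [← FederbushMean.dist1_SU_eq]; exact hα i
    rw [norm_sub_rev]
    exact h1.trans (mul_le_mul_of_nonneg_right (mul_le_mul_of_nonneg_left hW1 (by norm_num)) (norm_nonneg _))
  calc (Fintype.card (Idx P) : ℝ)⁻¹ * ‖∑ i : Idx P, (ξ (emb c.src) - ((loopHol U₀ c i : Matrix.specialUnitaryGroup n ℂ) : Matrix n n ℂ) * ξ (emb c.src) *
          star ((loopHol U₀ c i : Matrix.specialUnitaryGroup n ℂ) : Matrix n n ℂ))‖
      ≤ (Fintype.card (Idx P) : ℝ)⁻¹ * ∑ i : Idx P, (2 * α * ‖ξ (emb c.src)‖) :=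
        mul_le_mul_of_nonneg_left ((norm_sum_le _ _).trans (Finset.sum_le_sum fun i _ => hpt i)) (by positivity)
    _ = 2 * α * ‖ξ (emb c.src)‖ := by
        rw [Finset.sum_const, Finset.card_univ, nsmul_eq_mul]
        field_simp

end Summit.QuantumFields.YangMills.Theorems.Prop7CovLinAvgPureGauge

end
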